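import Summits.BirchSwinnertonDyer.BirchSwinnertonDyer.Theorems.GoldfeldAllTwistsTwoConverseTwinEvenTwistLocalPOne
import HarnessLib

set_option linter.dupNamespace false -- namespace `…BirchSwinnertonDyer.BirchSwinnertonDyer…` is the cell's (D-0017 nested layout)
set_option autoImplicit false

/-!
# Cell C7A, file D0-(Lα′): the TYPE-α ROOT TESTS at `p ≡ 1 (mod 8)` — the eight quartics `e′X⁴ + cX² + e` of the `p`-divisible descent classes
# have NO root modulo a type-α prime (FACT-FREE)

Cell `bsd-goldfeld`, seat `bsd-goldfeld-s1p-c3x` (gen 13); planner RULING (ccclx) «OBJECT C7A BY THE χ_Z CHANNEL», tranche T0, file D0-(Lα′) (memo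
`HOME/C7A-CHIZ-CHANNEL.md` §3). `--supports stmt-BirchSwinnertonDyer-20044` as a HELPER. Theses-free, Mathlib-only below the cell's F1a; theorems only; no
definition, no fact, no `sorry`. FRONTIER-grade: a twist-density-ZERO sub-family modulo named print downstream; never distance-to-summit.

WHY. In the `2`-isogeny descents of `49a1^{(p)}`, `49a1^{(2p)}`, `49a1^{(−qp)}`, `W = 49a1^{(−2qp)}` a class `d` divisible by `p` dies at `p` as soon as the
reduced quartic `e′X⁴ + cX² + e` (`a = pc`, `d = pe`, `d′ = pe′`) has no root mod `p` (part I's `not_isSoluble_padic_of_prime_dvd_coeffs_of_roots`, in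
its «no root `T = X²` is a square» form). For the eight classes that the C7A Selmer sets must lose at `p` (memo §3, kit/killtable) the quartics are,
up to the unit `±q`:
  `Q₁ = 28X⁴ + 84X² − 1`, `Q₂ = 4X⁴ − 84X² − 7` (classes `−qp, 7qp ∈ S′(W)`; `p, −7p ∈ S′(49a1^{(2p)})`),
  `Q₅ = 7X⁴ + 42X² − 1`, `Q₆ = X⁴ − 42X² − 7` (classes `p, −7p ∈ S′(49a1^{(p)})`; `−qp, 7qp ∈ S′(49a1^{(−qp)})`),
  `Q₃ = 448X⁴ + 42X² + 1`, `Q₄ = 64X⁴ + 42X² + 7` (classes `p, 7p ∈ S(49a1^{(2p)})`), `Q₇ = 112X⁴ + 21X² + 1`, `Q₈ = 16X⁴ + 21X² + 7` (classes `p, 7p ∈ S(49a1^{(p)})`).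
THE IDENTITIES (§1, any field with `2, 7 ≠ 0`): a root `X` of `Q₁, Q₂, Q₅, Q₆` yields `m` with `m⁴ = 7` (the square root `r` of `7` that the root produces —
e.g. `r = (14X² + 21)/8` for `Q₁` — is itself a square: `2(21 + 8r) = r(3 + r)²`), and a root of `Q₃, Q₄, Q₇, Q₈` yields `m⁴ = −7` (via the split-symbol
identity `8(s − 21) = s(1 − s)⁴`, `s² = −7`, of `…TwinSplitSymbolQuartic`); `Q₅, Q₆, Q₄` need `√2`, `Q₃` needs `√−2`, `Q₇` needs `√−1` — all present at
`p ≡ 1 (mod 8)`. §2: at a prime `p ≡ 1 (mod 8)` a fourth root of `7` gives one of `−7` (F1a's `exists_pow_four_eq_seven` read backwards), so under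
TYPE α (`¬ ∃ x, x⁴ = −7`) none of the eight quartics has a root in `𝔽_p` (`Qᵢ_ne_zero_of_alpha`).
HONEST FRAMING: residue arithmetic only; no Selmer set is bounded here; items 19140 / 19350 / 20044 unchanged; BSD is not proved by any of this.

References: [CoatesLiTianZhai2015] §5 (types α/β); [SilvermanAEC2009] Prop. X.4.9, Example X.4.10.
-/

namespace Summit.BirchSwinnertonDyer.BirchSwinnertonDyer.Theorems.GoldfeldGoodTwists

/-! ## §1 Root ⇒ fourth root of `±7` (abstract field) -/

section Field
variable {F : Type*} [Field F]

/-- `Q₁`: a root of `28X⁴ + 84X² − 1` gives `m⁴ = 7` (`m = (3 − 14X²)/(16X)`, `m² = (14X² + 21)/8 =: r`, `r² = 7`). [folklore] -/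
theorem exists_pow_four_eq_seven_of_root_Q1 (h2 : (2 : F) ≠ 0) {X : F} (hX : 28 * X ^ 4 + 84 * X ^ 2 - 1 = 0) :
    ∃ m : F, m ^ 4 = 7 := by
  have hX0 : X ≠ 0 := by rintro rfl; norm_num at hX
  have h16 : (16 : F) * X ≠ 0 := mul_ne_zero (by rw [show (16 : F) = 2 ^ 4 by norm_num]; exact pow_ne_zero 4 h2) hX0
  have h8 : (8 : F) ≠ 0 := by rw [show (8 : F) = 2 ^ 3 by norm_num]; exact pow_ne_zero 3 h2
  refine ⟨(3 - 14 * X ^ 2) / (16 * X), ?_⟩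
  have hsq : ((3 - 14 * X ^ 2) / (16 * X)) ^ 2 = (14 * X ^ 2 + 21) / 8 := by
    rw [div_pow, div_eq_div_iff (pow_ne_zero 2 h16) h8]
    linear_combination (-72 : F) * hX
  rw [show ∀ y : F, y ^ 4 = (y ^ 2) ^ 2 from fun y ↦ by ring, hsq, div_pow, div_eq_iff (pow_ne_zero 2 h8)]
  linear_combination (7 : F) * hX

/-- `Q₂`: a root of `4X⁴ − 84X² − 7` gives `m⁴ = 7` (`m = 16X/(2X² + 3)`, `m² = (2X² − 21)/8 =: r`, `r² = 7`). [folklore] -/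
theorem exists_pow_four_eq_seven_of_root_Q2 (h2 : (2 : F) ≠ 0) {X : F} (hX : 4 * X ^ 4 - 84 * X ^ 2 - 7 = 0) :
    ∃ m : F, m ^ 4 = 7 := by
  have h128 : (128 : F) ≠ 0 := by rw [show (128 : F) = 2 ^ 7 by norm_num]; exact pow_ne_zero 7 h2
  have hD : 2 * X ^ 2 + 3 ≠ 0 := by
    intro h
    apply h128
    linear_combination hX - (2 * X ^ 2 - 45) * h
  have h8 : (8 : F) ≠ 0 := by rw [show (8 : F) = 2 ^ 3 by norm_num]; exact pow_ne_zero 3 h2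
  refine ⟨16 * X / (2 * X ^ 2 + 3), ?_⟩
  have hsq : (16 * X / (2 * X ^ 2 + 3)) ^ 2 = (2 * X ^ 2 - 21) / 8 := by
    rw [div_pow, div_eq_div_iff (pow_ne_zero 2 hD) h8]
    linear_combination (-(2 * X ^ 2 + 27)) * hX
  rw [show ∀ y : F, y ^ 4 = (y ^ 2) ^ 2 from fun y ↦ by ring, hsq, div_pow, div_eq_iff (pow_ne_zero 2 h8)]
  linear_combination hX

/-- `Q₅`: a root of `7X⁴ + 42X² − 1` gives `m⁴ = 7` when `2 = a²` (`m = (3 − 7X²)/(8aX)`, `m² = (7X² + 21)/8`). [folklore] -/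
theorem exists_pow_four_eq_seven_of_root_Q5 (h2 : (2 : F) ≠ 0) {a : F} (ha : a ^ 2 = 2) {X : F} (hX : 7 * X ^ 4 + 42 * X ^ 2 - 1 = 0) :
    ∃ m : F, m ^ 4 = 7 := by
  have hX0 : X ≠ 0 := by rintro rfl; norm_num at hX
  have ha0 : a ≠ 0 := by rintro rfl; apply h2; linear_combination (-1 : F) * ha
  have h8 : (8 : F) ≠ 0 := by rw [show (8 : F) = 2 ^ 3 by norm_num]; exact pow_ne_zero 3 h2
  have hD : 8 * a * X ≠ 0 := mul_ne_zero (mul_ne_zero h8 ha0) hX0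
  refine ⟨(3 - 7 * X ^ 2) / (8 * a * X), ?_⟩
  have hsq : ((3 - 7 * X ^ 2) / (8 * a * X)) ^ 2 = (7 * X ^ 2 + 21) / 8 := by
    rw [div_pow, div_eq_div_iff (pow_ne_zero 2 hD) h8]
    linear_combination (-72 : F) * hX - (64 * X ^ 2 * (7 * X ^ 2 + 21)) * ha
  rw [show ∀ y : F, y ^ 4 = (y ^ 2) ^ 2 from fun y ↦ by ring, hsq, div_pow, div_eq_iff (pow_ne_zero 2 h8)]
  linear_combination (7 : F) * hX

/-- `Q₆`: a root of `X⁴ − 42X² − 7` gives `m⁴ = 7` when `2 = a²` (`m = 8aX/(X² + 3)`, `m² = (X² − 21)/8`). [folklore] -/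
theorem exists_pow_four_eq_seven_of_root_Q6 (h2 : (2 : F) ≠ 0) {a : F} (ha : a ^ 2 = 2) {X : F} (hX : X ^ 4 - 42 * X ^ 2 - 7 = 0) :
    ∃ m : F, m ^ 4 = 7 := by
  have h128 : (128 : F) ≠ 0 := by rw [show (128 : F) = 2 ^ 7 by norm_num]; exact pow_ne_zero 7 h2
  have hD : X ^ 2 + 3 ≠ 0 := by
    intro h
    apply h128
    linear_combination hX - (X ^ 2 - 45) * h
  have h8 : (8 : F) ≠ 0 := by rw [show (8 : F) = 2 ^ 3 by norm_num]; exact pow_ne_zero 3 h2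
  refine ⟨8 * a * X / (X ^ 2 + 3), ?_⟩
  have hsq : (8 * a * X / (X ^ 2 + 3)) ^ 2 = (X ^ 2 - 21) / 8 := by
    rw [div_pow, div_eq_div_iff (pow_ne_zero 2 hD) h8]
    linear_combination (-(X ^ 2 + 27)) * hX + (512 * X ^ 2) * ha
  rw [show ∀ y : F, y ^ 4 = (y ^ 2) ^ 2 from fun y ↦ by ring, hsq, div_pow, div_eq_iff (pow_ne_zero 2 h8)]
  linear_combination hX

/-- `Q₃`: a root of `448X⁴ + 42X² + 1` gives `m⁴ = −7` when `−2 = v²` (`s = 448X² + 21`, `s² = −7`; `m = v(112X² + 5)²/(2X)`, `m² = s`). [folklore] -/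
theorem exists_pow_four_eq_neg_seven_of_root_Q3 (h2 : (2 : F) ≠ 0) {v : F} (hv : v ^ 2 = -2) {X : F}
    (hX : 448 * X ^ 4 + 42 * X ^ 2 + 1 = 0) : ∃ m : F, m ^ 4 = -7 := by
  have hX0 : X ≠ 0 := by rintro rfl; norm_num at hX
  have hD : 2 * X ≠ 0 := mul_ne_zero h2 hX0
  refine ⟨v * (112 * X ^ 2 + 5) ^ 2 / (2 * X), ?_⟩
  have hsq : (v * (112 * X ^ 2 + 5) ^ 2 / (2 * X)) ^ 2 = 448 * X ^ 2 + 21 := by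
    rw [div_pow, div_eq_iff (pow_ne_zero 2 hD)]
    linear_combination ((112 * X ^ 2 + 5) ^ 4) * hv - (2 * (351232 * X ^ 4 + 29792 * X ^ 2 + 625)) * hX
  rw [show ∀ y : F, y ^ 4 = (y ^ 2) ^ 2 from fun y ↦ by ring, hsq]
  linear_combination (448 : F) * hX

/-- `Q₄`: a root of `64X⁴ + 42X² + 7` gives `m⁴ = −7` when `2 = a²` (`s = 64X² + 21`; `m = aX/(16X² + 5)²`, `m² = s`). [folklore] -/
theorem exists_pow_four_eq_neg_seven_of_root_Q4 (h2 : (2 : F) ≠ 0) {a : F} (ha : a ^ 2 = 2) {X : F}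
    (hX : 64 * X ^ 4 + 42 * X ^ 2 + 7 = 0) : ∃ m : F, m ^ 4 = -7 := by
  have h8 : (8 : F) ≠ 0 := by rw [show (8 : F) = 2 ^ 3 by norm_num]; exact pow_ne_zero 3 h2
  have hD : 16 * X ^ 2 + 5 ≠ 0 := by
    intro h
    apply one_ne_zero (α := F)
    linear_combination (8 : F) * hX - (32 * X ^ 2 + 11) * h
  refine ⟨a * X / (16 * X ^ 2 + 5) ^ 2, ?_⟩
  have hsq : (a * X / (16 * X ^ 2 + 5) ^ 2) ^ 2 = 64 * X ^ 2 + 21 := by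
    rw [div_pow, div_eq_iff (pow_ne_zero 2 (pow_ne_zero 2 hD))]
    linear_combination (X ^ 2) * ha - (65536 * X ^ 6 + 60416 * X ^ 4 + 18464 * X ^ 2 + 1875) * hX
  rw [show ∀ y : F, y ^ 4 = (y ^ 2) ^ 2 from fun y ↦ by ring, hsq]
  linear_combination (64 : F) * hX

/-- `Q₇`: a root of `112X⁴ + 21X² + 1` gives `m⁴ = −7` when `−1 = j²` (`s = 224X² + 21`; `m = j(56X² + 5)²/X`, `m² = s`). [folklore] -/
theorem exists_pow_four_eq_neg_seven_of_root_Q7 {j : F} (hj : j ^ 2 = -1) {X : F} (hX : 112 * X ^ 4 + 21 * X ^ 2 + 1 = 0) :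
    ∃ m : F, m ^ 4 = -7 := by
  have hX0 : X ≠ 0 := by rintro rfl; norm_num at hX
  refine ⟨j * (56 * X ^ 2 + 5) ^ 2 / X, ?_⟩
  have hsq : (j * (56 * X ^ 2 + 5) ^ 2 / X) ^ 2 = 224 * X ^ 2 + 21 := by
    rw [div_pow, div_eq_iff (pow_ne_zero 2 hX0)]
    linear_combination ((56 * X ^ 2 + 5) ^ 4) * hj - (87808 * X ^ 4 + 14896 * X ^ 2 + 625) * hX
  rw [show ∀ y : F, y ^ 4 = (y ^ 2) ^ 2 from fun y ↦ by ring, hsq]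
  linear_combination (448 : F) * hX

/-- `Q₈`: a root of `16X⁴ + 21X² + 7` gives `m⁴ = −7` (`s = 32X² + 21`; `m = X/(8X² + 5)²`, `m² = s`; no auxiliary square root needed). [folklore] -/
theorem exists_pow_four_eq_neg_seven_of_root_Q8 {X : F} (hX : 16 * X ^ 4 + 21 * X ^ 2 + 7 = 0) : ∃ m : F, m ^ 4 = -7 := by
  have hD : 8 * X ^ 2 + 5 ≠ 0 := by
    intro h
    apply one_ne_zero (α := F)
    linear_combination (8 : F) * hX - (16 * X ^ 2 + 11) * h
  refine ⟨X / (8 * X ^ 2 + 5) ^ 2, ?_⟩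
  have hsq : (X / (8 * X ^ 2 + 5) ^ 2) ^ 2 = 32 * X ^ 2 + 21 := by
    rw [div_pow, div_eq_iff (pow_ne_zero 2 (pow_ne_zero 2 hD))]
    linear_combination (-(8192 * X ^ 6 + 15104 * X ^ 4 + 9232 * X ^ 2 + 1875)) * hX
  rw [show ∀ y : F, y ^ 4 = (y ^ 2) ^ 2 from fun y ↦ by ring, hsq]
  linear_combination (64 : F) * hX

end Field

/-! ## §2 At a type-α prime `p ≡ 1 (mod 8)`: none of the eight quartics has a root -/

section ZModPrime
variable {p : ℕ} [Fact p.Prime]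

/-- At `p ≡ 1 (mod 8)` a fourth root of `7` gives a fourth root of `−7`: `x = c(1 + i)/a` with `c⁴ = 7`, `i² = −1`, `a² = 2` has `x⁴ = 7·(2i)²/4 = −7`
(F1a's `exists_pow_four_eq_seven`, read backwards). [folklore] -/
theorem exists_pow_four_eq_neg_seven_of_seven (hp8 : p % 8 = 1) (h7 : ∃ c : ZMod p, c ^ 4 = 7) : ∃ x : ZMod p, x ^ 4 = -7 := by
  have hp : p.Prime := Fact.out
  obtain ⟨hp2, -, -, hp4⟩ := aux_of_mod_eight_one hp8
  obtain ⟨c, hc⟩ := h7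
  obtain ⟨i, hi⟩ := (ZMod.exists_sq_eq_neg_one_iff (p := p)).mpr (by omega)
  obtain ⟨a, ha⟩ := (ZMod.exists_sq_eq_two_iff hp2).mpr (Or.inl hp8)
  have h2 : (2 : ZMod p) ≠ 0 := by
    intro h
    have h' : ((2 : ℕ) : ZMod p) = 0 := by exact_mod_cast h
    rw [ZMod.natCast_eq_zero_iff] at h'
    exact hp2 ((Nat.prime_dvd_prime_iff_eq hp Nat.prime_two).mp h')
  have ha0 : a ≠ 0 := by rintro rfl; exact h2 (by rw [ha, mul_zero])
  refine ⟨c * (1 + i) * a⁻¹, ?_⟩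
  have hinv : a⁻¹ * a = 1 := inv_mul_cancel₀ ha0
  have h1i : (1 + i) ^ 2 = 2 * i := by linear_combination (-1 : ZMod p) * hi
  calc (c * (1 + i) * a⁻¹) ^ 4 = c ^ 4 * ((1 + i) ^ 2) ^ 2 * (a⁻¹) ^ 4 := by ring
    _ = 7 * (2 * i) ^ 2 * (a⁻¹) ^ 4 := by rw [hc, h1i]
    _ = -7 := by linear_combination (-28 * (a⁻¹) ^ 4) * hi - (7 * (2 * (a⁻¹) ^ 2 + 1) * (a⁻¹) ^ 2) * ha -
          (7 * (2 * (a⁻¹) ^ 2 + 1) * (a⁻¹ * a + 1)) * hinv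

/-- The square roots available at `p ≡ 1 (mod 8)`: `2 ≠ 0` and `a² = 2`, `v² = −2`, `j² = −1` for some `a, v, j`. [folklore] -/
theorem roots_of_mod_eight_one (hp8 : p % 8 = 1) :
    (2 : ZMod p) ≠ 0 ∧ (∃ a : ZMod p, a ^ 2 = 2) ∧ (∃ v : ZMod p, v ^ 2 = -2) ∧ (∃ j : ZMod p, j ^ 2 = -1) := by
  have hp : p.Prime := Fact.out
  obtain ⟨hp2, -, -, hp4⟩ := aux_of_mod_eight_one hp8
  have h2 : (2 : ZMod p) ≠ 0 := by
    intro h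
    have h' : ((2 : ℕ) : ZMod p) = 0 := by exact_mod_cast h
    rw [ZMod.natCast_eq_zero_iff] at h'
    exact hp2 ((Nat.prime_dvd_prime_iff_eq hp Nat.prime_two).mp h')
  obtain ⟨a, ha⟩ := (ZMod.exists_sq_eq_two_iff hp2).mpr (Or.inl hp8)
  obtain ⟨j, hj⟩ := (ZMod.exists_sq_eq_neg_one_iff (p := p)).mpr (by omega)
  refine ⟨h2, ⟨a, by rw [pow_two]; exact ha.symm⟩, ⟨j * a, ?_⟩, ⟨j, by rw [pow_two]; exact hj.symm⟩⟩
  rw [mul_pow, pow_two, pow_two, ← hj, ← ha]; ring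

/-- **Type α at `p ≡ 1 (mod 8)`: `Q₁, Q₂, Q₅, Q₆` (the `√7`-type quartics) have no root mod `p`.** [cite: CoatesLiTianZhai2015, §5] -/
theorem rootfree_seven_type_of_alpha (hp8 : p % 8 = 1) (hα : ¬ ∃ x : ZMod p, x ^ 4 = -7) (X : ZMod p) :
    28 * X ^ 4 + 84 * X ^ 2 - 1 ≠ 0 ∧ 4 * X ^ 4 - 84 * X ^ 2 - 7 ≠ 0 ∧ 7 * X ^ 4 + 42 * X ^ 2 - 1 ≠ 0 ∧ X ^ 4 - 42 * X ^ 2 - 7 ≠ 0 := by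
  obtain ⟨h2, ⟨a, ha⟩, -, -⟩ := roots_of_mod_eight_one hp8
  have H : ∀ {P : Prop}, (P → ∃ m : ZMod p, m ^ 4 = 7) → ¬ P := fun h hP ↦
    hα (exists_pow_four_eq_neg_seven_of_seven hp8 (h hP))
  exact ⟨H (exists_pow_four_eq_seven_of_root_Q1 h2), H (exists_pow_four_eq_seven_of_root_Q2 h2),
    H (exists_pow_four_eq_seven_of_root_Q5 h2 ha), H (exists_pow_four_eq_seven_of_root_Q6 h2 ha)⟩

/-- **Type α at `p ≡ 1 (mod 8)`: `Q₃, Q₄, Q₇, Q₈` (the `√−7`-type quartics) have no root mod `p`.** [cite: CoatesLiTianZhai2015, §5] -/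
theorem rootfree_negSeven_type_of_alpha (hp8 : p % 8 = 1) (hα : ¬ ∃ x : ZMod p, x ^ 4 = -7) (X : ZMod p) :
    448 * X ^ 4 + 42 * X ^ 2 + 1 ≠ 0 ∧ 64 * X ^ 4 + 42 * X ^ 2 + 7 ≠ 0 ∧ 112 * X ^ 4 + 21 * X ^ 2 + 1 ≠ 0 ∧ 16 * X ^ 4 + 21 * X ^ 2 + 7 ≠ 0 := by
  obtain ⟨h2, ⟨a, ha⟩, ⟨v, hv⟩, ⟨j, hj⟩⟩ := roots_of_mod_eight_one hp8
  have H : ∀ {P : Prop}, (P → ∃ m : ZMod p, m ^ 4 = -7) → ¬ P := fun h hP ↦ hα (h hP)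
  exact ⟨H (exists_pow_four_eq_neg_seven_of_root_Q3 h2 hv), H (exists_pow_four_eq_neg_seven_of_root_Q4 h2 ha),
    H (exists_pow_four_eq_neg_seven_of_root_Q7 hj), H exists_pow_four_eq_neg_seven_of_root_Q8⟩

end ZModPrime

end Summit.BirchSwinnertonDyer.BirchSwinnertonDyer.Theorems.GoldfeldGoodTwists
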